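import Summits.CriticalPhenomena.SAWScalingLimit.Theorems.SAWTotalPositivityCriticalBubbleBoundJoinSurgeryDefs

/-!
# Line `docking-census-joining` for the crux `SAWTotalPositivity.CriticalBubbleBound`
(stmt-CriticalPhenomena-7117), JOIN-MASS programme: bookkeeping of Madras' modification

Stubs `newCells_window` and `caseOf_window` of the lead's skeleton (c6, join-mass wave 2).

Madras' joining surgery (Hammond, Ann. Probab. 46 (2018) = arXiv:1808.09032, §4.1, re-designed in
`…JoinSurgeryDefs`) modifies a polygon `E` at its window `Y` according to one of EIGHT local cases
`JCase`, replacing one or two edges by an explicit nine- or ten-edge path `pathPts c` (sites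
relative to `Y`).  This file records two pieces of pure bookkeeping:

* `newCells_window` — where the FRESH (interior) sites `newCells c Y` of each case lie: in the
  box `[Y 0, Y 0 + 3] × [Y 1 - 2, Y 1 + 2]`, inside the three window rows in the `A` cases, weakly
  above row `Y 1 - 1` in the `B` cases, weakly below row `Y 1 + 1` in the `C` cases, and in the
  columns `≤ Y 0 + 2` in the cases `B1`, `C1` (read off the explicit finite tables);
* `caseOf_window` — which case family the selector `caseOf E Y` returns, together with the window
  vertex it found: `A` iff `Y` is a vertex, `B` iff `Y` is not but `Y + e₁` is, `C` otherwise
  (and then `Y - e₁` is a vertex, granted that the window meets `E` at all).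
-/

noncomputable section

open Literature.Probability.LatticeModels
open Literature.Probability.RandomPlanarGeometry Literature.Probability.RandomPlanarGeometry.SAW
open scoped BigOperators
open Summit.CriticalPhenomena.SAWScalingLimit.Theorems.CriticalBubbleBound.Negative (e₀)
open Summit.CriticalPhenomena.SAWScalingLimit.Theorems.CriticalBubbleBound.Docking

namespace Summit.CriticalPhenomena.SAWScalingLimit.Theorems.CriticalBubbleBound.Join

/-! ## The fresh cells of each case -/

/-- The RELATIVE interior sites of the added path of each case lie in `[0, 3] × [-2, 2]`, with the
finer row/column constraints per case family (a finite check on the explicit tables `pathPts`).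
[cite: Hammond2015SAPJoining, §4.1 (Figure: Madras' cases)] -/
private theorem relCells_window (c : JCase) : ∀ d ∈ ((pathPts c).tail).dropLast,
    0 ≤ d.1 ∧ d.1 ≤ 3 ∧ -2 ≤ d.2 ∧ d.2 ≤ 2 ∧
    ((c = JCase.Aup ∨ c = JCase.Adown) → -1 ≤ d.2 ∧ d.2 ≤ 1) ∧
    ((c = JCase.B1 ∨ c = JCase.B2a ∨ c = JCase.B2b) → -1 ≤ d.2) ∧
    ((c = JCase.C1 ∨ c = JCase.C2a ∨ c = JCase.C2b) → d.2 ≤ 1) ∧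
    ((c = JCase.B1 ∨ c = JCase.C1) → d.1 ≤ 2) := by
  cases c <;> decide

/-- Coordinates of the site `pt Y d = Y + (d.1, d.2)`. [folklore] -/
private theorem pt_apply (Y : Site 2) (d : ℤ × ℤ) :
    pt Y d 0 = Y 0 + d.1 ∧ pt Y d 1 = Y 1 + d.2 := by
  simp [pt]

/-- WHERE THE FRESH CELLS LIE.  Every interior site `p` of the added path of case `c` at the window
`Y` lies in the box `[Y 0, Y 0 + 3] × [Y 1 - 2, Y 1 + 2]`; in the `A` cases inside the three window
rows `Y 1 - 1 … Y 1 + 1`; in the `B` cases weakly above row `Y 1 - 1`; in the `C` cases weakly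
below row `Y 1 + 1`; and in the cases `B1`, `C1` in the columns `≤ Y 0 + 2`.
[cite: Hammond2015SAPJoining, §4.1 (Figure: Madras' cases)] -/
theorem newCells_window : ∀ (c : JCase) (Y p : Site 2), p ∈ newCells c Y → Y 0 ≤ p 0 ∧ p 0 ≤ Y 0 + 3 ∧ Y 1 - 2 ≤ p 1 ∧ p 1 ≤ Y 1 + 2 ∧ ((c = JCase.Aup ∨ c = JCase.Adown) → Y 1 - 1 ≤ p 1 ∧ p 1 ≤ Y 1 + 1) ∧ ((c = JCase.B1 ∨ c = JCase.B2a ∨ c = JCase.B2b) → Y 1 - 1 ≤ p 1) ∧ ((c = JCase.C1 ∨ c = JCase.C2a ∨ c = JCase.C2b) → p 1 ≤ Y 1 + 1) ∧ ((c = JCase.B1 ∨ c = JCase.C1) → p 0 ≤ Y 0 + 2) := by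
  intro c Y p hp
  obtain ⟨d, hd, rfl⟩ : ∃ d ∈ ((pathPts c).tail).dropLast, pt Y d = p := by
    simpa only [newCells, List.mem_toFinset, List.mem_map] using hp
  obtain ⟨h0, h1⟩ := pt_apply Y d
  obtain ⟨k1, k2, k3, k4, k5, k6, k7, k8⟩ := relCells_window c d hd
  refine ⟨by omega, by omega, by omega, by omega, fun hc => ?_, fun hc => ?_, fun hc => ?_,
    fun hc => ?_⟩
  · have := k5 hc; omega
  · have := k6 hc; omega
  · have := k7 hc; omega
  · have := k8 hc; omega

/-! ## The case selector and the window vertex -/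

/-- WHICH CASE FAMILY `caseOf` SELECTS.  If the vertical 3-window `{Y - e₁, Y, Y + e₁}` meets the
edge set `E`, then: the selected case is an `A` case exactly when `Y` is a vertex of `E`; a `B` case
exactly when `Y` is not a vertex but `Y + e₁` is; and otherwise a `C` case, in which event the
window vertex is `Y - e₁`. [cite: Hammond2015SAPJoining, §4.1 (Figure: Madras' cases)] -/
theorem caseOf_window : ∀ (E : Finset (Sym2 (Site 2))) (Y : Site 2), (IsV E (Y - e₁) ∨ IsV E Y ∨ IsV E (Y + e₁)) → ((caseOf E Y = JCase.Aup ∨ caseOf E Y = JCase.Adown) ∧ IsV E Y) ∨ ((caseOf E Y = JCase.B1 ∨ caseOf E Y = JCase.B2a ∨ caseOf E Y = JCase.B2b) ∧ ¬ IsV E Y ∧ IsV E (Y + e₁)) ∨ ((caseOf E Y = JCase.C1 ∨ caseOf E Y = JCase.C2a ∨ caseOf E Y = JCase.C2b) ∧ ¬ IsV E Y ∧ ¬ IsV E (Y + e₁) ∧ IsV E (Y - e₁)) := by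
  intro E Y hwin
  by_cases hA : IsV E Y
  · refine Or.inl ⟨?_, hA⟩
    unfold caseOf
    rw [if_pos hA]
    split_ifs
    · exact Or.inl rfl
    · exact Or.inr rfl
  · by_cases hB : IsV E (Y + e₁)
    · refine Or.inr (Or.inl ⟨?_, hA, hB⟩)
      unfold caseOf
      rw [if_neg hA, if_pos hB]
      split_ifs
      · exact Or.inr (Or.inl rfl)
      · exact Or.inr (Or.inr rfl)
      · exact Or.inl rfl
    · have hC : IsV E (Y - e₁) :=
        hwin.elim id fun h => h.elim (fun h => absurd h hA) fun h => absurd h hB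
      refine Or.inr (Or.inr ⟨?_, hA, hB, hC⟩)
      unfold caseOf
      rw [if_neg hA, if_neg hB]
      split_ifs
      · exact Or.inr (Or.inl rfl)
      · exact Or.inr (Or.inr rfl)
      · exact Or.inl rfl

end Summit.CriticalPhenomena.SAWScalingLimit.Theorems.CriticalBubbleBound.Join

end
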